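import Summits.FinalStateConjecture.FinalStateConjecture.Theses.SwallowTheDatum
import Literature.Geometry.Lorentzian.ConvergenceTransport
import HarnessLib

/-!
# Crux `SwallowTheDatum.UniversalWitnessFamily` (stmt-FinalStateConjecture-10051), line `Sketch`
# (throat-settles-too), stub `stub_decompositionPushforward`

**Final-state decompositions push forward along isometric open embeddings of spacetimes.**  Let
`χ : 𝓢 → 𝓢'` be smooth, an open embedding, an isometric immersion (`χ^* g' = g`) and
time-orientation preserving, and let `dec` be a `C²` final-state decomposition
(`FinalStateDecomposition`, `KerrConvergence.lean`) of `O ⊆ 𝓢` with sub-extremal holes and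
exhaustive charts (`Summit.FinalStateConjecture.HasExhaustiveCharts`).  Then `χ_* dec` — the same
number of holes, masses, spins, motions, late time `τ₀`, excision radii and flat domain, with the
charts `χ ∘ chartᵢ` and `χ ∘ flatChart` — is a `C²` final-state decomposition of `χ(O) ⊆ 𝓢'` with
charted region `χ(dec.charted)`, sub-extremal holes and exhaustive charts.

Field by field (pure bookkeeping over the prelude):

* `IsLateChart` — smoothness and open embeddings compose (`isLateChart_comp`), the late image lies
  in `χ(O)`;
* every deviation clause transfers VERBATIM, because the deviation functions are equal:
  `(χ ∘ Ψ)^* g' − g₀ = Ψ^*(χ^* g') − g₀ = Ψ^* g − g₀` (`Spacetime.deviation_comp`, chain rule and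
  isometry), whence `deviationCk`/`truncDeviationCk` of `χ ∘ Ψ` in `𝓢'` equal those of `Ψ` in `𝓢`
  (`deviationCk_comp`, `truncDeviationCk_comp`);
* separation of the truncated world-tubes — images under the injective `χ` stay disjoint;
* the covering clause and clause (ii) of `HasExhaustiveCharts` — `χ(O) ∖ χ(A) = χ(O ∖ A)`
  (injectivity) `⊆ χ(J⁻(S)) ⊆ J⁻(χ(S))` (`LorentzianMetric.image_causalPast_subset`), with the
  certified late region / certified slab of `χ_* dec` equal to the `χ`-images of those of `dec`.

References: B. O'Neill, *Semi-Riemannian geometry* (1983), Ch. 3, p. 58 and pp. 90–91 (pullbacks,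
local isometries), Ch. 14, pp. 402–403 (causal relations under maps); M. Dafermos, J. Luk,
arXiv:1710.01722, Conjecture 1; DHRT arXiv:2104.08222, §1 (consequence form of convergence, as
vendored in `KerrConvergence`).
-/

set_option linter.dupNamespace false

noncomputable section

open scoped Manifold ContDiff Topology
open Set Function Filter Topology Literature.Geometry.Lorentzian

namespace Summit.FinalStateConjecture.FinalStateConjecture.Theorems.SwallowTheDatum.UniversalWitnessFamily

/-! ## Transport of the generic layer of `KerrConvergence` along `χ` -/

section Transport

variable {𝓢 𝓢' : Spacetime.{0} 4} {χ : 𝓢.carrier → 𝓢'.carrier}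

/-- **Late-time charts push forward along smooth open embeddings**: if `Ψ` is a late-time chart of
the background `B` into `O ⊆ 𝓢` after `τ₀` and `χ : 𝓢 → 𝓢'` is a smooth open embedding, then
`χ ∘ Ψ` is a late-time chart into `χ(O) ⊆ 𝓢'` after `τ₀` (smoothness and open embeddings compose;
`(χ ∘ Ψ)({t > τ₀}) = χ(Ψ({t > τ₀})) ⊆ χ(O)`). DHRT arXiv:2104.08222, §1 (consequence form, as
vendored in `KerrConvergence`). -/
theorem isLateChart_comp (B : ModelBackground) {O : Set 𝓢.carrier} {τ₀ : ℝ}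
    {Ψ : B.domain → 𝓢.carrier} (hΨ : 𝓢.IsLateChart B O τ₀ Ψ)
    (hχ : ContMDiff (𝓡 4) (𝓡 4) ∞ χ) (hχo : IsOpenEmbedding χ) :
    𝓢'.IsLateChart B (χ '' O) τ₀ (χ ∘ Ψ) where
  contMDiff := hχ.comp hΨ.contMDiff
  isOpenEmbedding := hχo.comp hΨ.isOpenEmbedding
  image_subset := by
    rw [image_comp]
    exact image_mono hΨ.image_subset

/-- The extended metric deviation is invariant under composition with an isometric immersion:
`(χ ∘ Ψ)^* g' − g₀ = Ψ^* g − g₀` extended by zero (`Spacetime.deviation_comp`). O'Neill 1983,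
Ch. 3, p. 58. -/
theorem deviationExtend_comp (B : ModelBackground) (hχd : MDifferentiable (𝓡 4) (𝓡 4) χ)
    (hφ : ∀ y, pullbackBilin (I := 𝓡 4) (I' := 𝓡 4) χ 𝓢'.metric.val y = 𝓢.metric.val y)
    {Ψ : B.domain → 𝓢.carrier} (hΨ : MDifferentiable 𝓘(ℝ, E4) (𝓡 4) Ψ) :
    𝓢'.deviationExtend B (χ ∘ Ψ) = 𝓢.deviationExtend B Ψ := by
  unfold Spacetime.deviationExtend
  rw [Spacetime.deviation_comp B hχd hφ hΨ]

/-- The `Cᵏ` slab deviation is invariant under composition with an isometric immersion: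
`deviationCk (χ ∘ Ψ) = deviationCk Ψ`. DHRT arXiv:2104.08222, §1; O'Neill 1983, Ch. 3, p. 58. -/
theorem deviationCk_comp (B : ModelBackground) (hχd : MDifferentiable (𝓡 4) (𝓡 4) χ)
    (hφ : ∀ y, pullbackBilin (I := 𝓡 4) (I' := 𝓡 4) χ 𝓢'.metric.val y = 𝓢.metric.val y)
    {Ψ : B.domain → 𝓢.carrier} (hΨ : MDifferentiable 𝓘(ℝ, E4) (𝓡 4) Ψ) (k : ℕ) (τ : ℝ) :
    𝓢'.deviationCk B (χ ∘ Ψ) k τ = 𝓢.deviationCk B Ψ k τ := by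
  unfold Spacetime.deviationCk
  rw [deviationExtend_comp B hχd hφ hΨ]

/-- The truncated `Cᵏ` slab deviation is invariant under composition with an isometric
immersion: `truncDeviationCk (χ ∘ Ψ) = truncDeviationCk Ψ`. DHRT arXiv:2104.08222, §1; O'Neill
1983, Ch. 3, p. 58. -/
theorem truncDeviationCk_comp (B : ModelBackground) (hχd : MDifferentiable (𝓡 4) (𝓡 4) χ)
    (hφ : ∀ y, pullbackBilin (I := 𝓡 4) (I' := 𝓡 4) χ 𝓢'.metric.val y = 𝓢.metric.val y)
    {Ψ : B.domain → 𝓢.carrier} (hΨ : MDifferentiable 𝓘(ℝ, E4) (𝓡 4) Ψ) (k : ℕ) (R τ : ℝ) :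
    𝓢'.truncDeviationCk B (χ ∘ Ψ) k R τ = 𝓢.truncDeviationCk B Ψ k R τ := by
  unfold Spacetime.truncDeviationCk
  rw [deviationExtend_comp B hχd hφ hΨ]

/-- **Covering clauses push forward**: if `O ∖ A ⊆ J⁻(S)` in `𝓢` and `χ : 𝓢 → 𝓢'` is an
injective, differentiable, time-orientation preserving isometric immersion, then
`χ(O) ∖ χ(A) = χ(O ∖ A) ⊆ χ(J⁻(S)) ⊆ J⁻(χ(S))` in `𝓢'` (`Set.image_sdiff`,
`LorentzianMetric.image_causalPast_subset`). O'Neill 1983, Ch. 14, p. 403. -/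
theorem image_diff_subset_causalPast_image (hχd : MDifferentiable (𝓡 4) (𝓡 4) χ)
    (hτ : 𝓢.timeOrientation.PreservesTimeOrientation χ 𝓢'.timeOrientation)
    (hφ : ∀ y, pullbackBilin (I := 𝓡 4) (I' := 𝓡 4) χ 𝓢'.metric.val y = 𝓢.metric.val y)
    (hinj : Injective χ) {O A S : Set 𝓢.carrier}
    (h : O \ A ⊆ 𝓢.metric.causalPast 𝓢.timeOrientation S) :
    χ '' O \ χ '' A ⊆ 𝓢'.metric.causalPast 𝓢'.timeOrientation (χ '' S) := by
  rw [← image_sdiff hinj]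
  exact (image_mono h).trans (LorentzianMetric.image_causalPast_subset hχd hτ hφ S)

/-- Images of the truncated world-tubes under an injective `χ` stay pairwise disjoint
(`Set.disjoint_image_iff`). [folklore] -/
theorem pairwise_disjoint_image_comp {ι : Type*} {α : ι → Type*} (hinj : Injective χ)
    (f : ∀ i, α i → 𝓢.carrier) (s : ∀ i, Set (α i))
    (h : Pairwise (Function.onFun Disjoint fun i ↦ f i '' s i)) :
    Pairwise (Function.onFun Disjoint fun i ↦ (χ ∘ f i) '' s i) := by
  intro i j hij
  have hd := h hij
  simp only [Function.onFun, image_comp] at hd ⊢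
  exact (disjoint_image_iff hinj).2 hd

end Transport

/-! ## The stub -/

/-- **Stub T2 — `stub_decompositionPushforward`.**  A final-state decomposition PUSHES FORWARD
along an isometric open embedding of spacetimes: if `χ : 𝓢 → 𝓢'` is smooth, an open embedding,
isometric (`χ^* g' = g`) and time-orientation preserving, and `dec` is a `C²` decomposition of
`O ⊆ 𝓢` with sub-extremal holes and `HasExhaustiveCharts`, then `χ_* dec` — same `N`, masses,
spins, motions, `τ₀`, excision radii and flat domain; charts `χ ∘ chartᵢ`, `χ ∘ flatChart` — is a
`C²` decomposition of `χ(O) ⊆ 𝓢'` with charted region `χ(dec.charted)`, sub-extremal holes and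
`HasExhaustiveCharts`.  Field by field: `IsLateChart` (composition with a smooth open embedding;
image `⊆ χ O`); the deviations are IDENTICAL, `(χ ∘ Ψ)^* g' = Ψ^*(χ^* g') = Ψ^* g` (chain rule
`mfderiv_comp` + `IsIsometricImmersion`), so every `deviationCk`/`truncDeviationCk` clause
transfers verbatim; disjointness of truncated tubes (`χ` injective); the two covering clauses and
`HasExhaustiveCharts` (ii) by `χ(O ∖ A) = χ O ∖ χ A` (injectivity) and
`χ (J⁻_𝓢(S)) ⊆ J⁻_{𝓢'}(χ S)` (`LorentzianMetric.image_causalPast_subset`).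
[cite: DafermosLuk2017, Conjecture 1] [cite: arXiv210408222, §1] [cite: ONeill1983, Ch. 3, pp. 90–91] -/
theorem stub_decompositionPushforward :
    ∀ (𝓢 𝓢' : Spacetime.{0} 4) (χ : 𝓢.carrier → 𝓢'.carrier),
    ContMDiff (𝓡 4) (𝓡 4) ∞ χ → Topology.IsOpenEmbedding χ →
    𝓢.metric.IsIsometricImmersion 𝓢'.metric.toPseudoRiemannianMetric χ →
    𝓢.timeOrientation.PreservesTimeOrientation χ 𝓢'.timeOrientation →
    ∀ (O : Set 𝓢.carrier) (dec : FinalStateDecomposition 𝓢 O 2),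
      (∀ i, Kerr.IsSubextremal (dec.mass i) (dec.spin i)) →
      Summit.FinalStateConjecture.HasExhaustiveCharts dec →
      ∃ dec' : FinalStateDecomposition 𝓢' (χ '' O) 2,
        (∀ i, Kerr.IsSubextremal (dec'.mass i) (dec'.spin i)) ∧
        dec'.charted = χ '' dec.charted ∧
        Summit.FinalStateConjecture.HasExhaustiveCharts dec' := by
  intro 𝓢 𝓢' χ hχ hχo hiso hτ O dec hsub hex
  -- Statement re-type T2 (p126844, 2026-08-16): `HasExhaustiveCharts` now carries the honest-radii clause
  -- `∀ i, Tendsto (R i) atTop atTop ∧ ∀ τ, max r₊ 0 + 1 ≤ R i τ` as its FIRST component; it transfers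
  -- verbatim to `χ_* dec` (same `R`, same masses and spins).
  obtain ⟨R, hR0, hR, hcov⟩ := hex
  have hinj : Injective χ := hχo.injective
  have hχd : MDifferentiable (𝓡 4) (𝓡 4) χ := hχ.mdifferentiable (by simp)
  have hφ : ∀ y, pullbackBilin (I := 𝓡 4) (I' := 𝓡 4) χ 𝓢'.metric.val y = 𝓢.metric.val y :=
    hiso.2
  have hΨd : ∀ i, MDifferentiable 𝓘(ℝ, E4) (𝓡 4) (dec.chart i) := fun i ↦
    (dec.isLateChart i).contMDiff.mdifferentiable (by simp)
  have hΨ₀d : MDifferentiable 𝓘(ℝ, E4) (𝓡 4) dec.flatChart :=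
    dec.isLateChart_flat.contMDiff.mdifferentiable (by simp)
  -- the pushed-forward decomposition `χ_* dec`
  let dec' : FinalStateDecomposition 𝓢' (χ '' O) 2 :=
    { N := dec.N
      mass := dec.mass
      spin := dec.spin
      mass_pos := dec.mass_pos
      abs_spin_le_mass := dec.abs_spin_le_mass
      motion := dec.motion
      τ₀ := dec.τ₀
      chart := fun i ↦ χ ∘ dec.chart i
      isLateChart := fun i ↦ isLateChart_comp _ (dec.isLateChart i) hχ hχo
      tendsto_truncDeviationCk := fun i R' ↦ (dec.tendsto_truncDeviationCk i R').congr fun τ ↦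
        (truncDeviationCk_comp (dec.background i) hχd hφ (hΨd i) 2 R' τ).symm
      exists_pairwise_disjoint := fun R' ↦ by
        obtain ⟨τ₁, hτ₁⟩ := dec.exists_pairwise_disjoint R'
        exact ⟨τ₁, pairwise_disjoint_image_comp hinj _ _ hτ₁⟩
      excision := dec.excision
      tendsto_excision_div := dec.tendsto_excision_div
      flatDomain := dec.flatDomain
      setOf_lt_excision_subset_flatDomain := dec.setOf_lt_excision_subset_flatDomain
      flatChart := χ ∘ dec.flatChart
      isLateChart_flat := isLateChart_comp _ dec.isLateChart_flat hχ hχo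
      tendsto_deviationCk_flat := dec.tendsto_deviationCk_flat.congr fun τ ↦
        (deviationCk_comp (Minkowski.backgroundOn dec.flatDomain) hχd hφ hΨ₀d 2 τ).symm
      diff_subset_causalPast := by
        have h := image_diff_subset_causalPast_image hχd hτ hφ hinj dec.diff_subset_causalPast
        simpa only [image_union, image_iUnion, image_comp] using h }
  refine ⟨dec', hsub, ?_, R, hR0, fun i ↦ ?_, fun τ₁ hτ₁ ↦ ?_⟩
  · -- the charted region
    simp only [dec', FinalStateDecomposition.charted, FinalStateDecomposition.radiationZone,
      FinalStateDecomposition.region, FinalStateDecomposition.background, image_union,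
      image_iUnion, image_comp]
  · -- clause (i): near-zone convergence out to `Rᵢ(τ)`, same deviation function
    exact (hR i).congr fun τ ↦
      (truncDeviationCk_comp (dec.background i) hχd hφ (hΨd i) 2 (R i τ) τ).symm
  · -- clause (ii): the certified regions of `χ_* dec` are the `χ`-images of those of `dec`
    have hlate : certifiedLate dec' R τ₁ = χ '' certifiedLate dec R τ₁ := by
      simp only [dec', certifiedLate, FinalStateDecomposition.background, image_union,
        image_iUnion, image_comp]
    have hslab : certifiedSlab dec' R τ₁ = χ '' certifiedSlab dec R τ₁ := by
      simp only [dec', certifiedSlab, FinalStateDecomposition.background, image_union,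
        image_iUnion, image_comp]
    rw [hlate, hslab]
    exact image_diff_subset_causalPast_image hχd hτ hφ hinj (hcov τ₁ hτ₁)

end Summit.FinalStateConjecture.FinalStateConjecture.Theorems.SwallowTheDatum.UniversalWitnessFamily

end
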